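import Summits.QuantumFields.YangMills.Theorems.BalabanUVNodesN20KeyedRelWeightFraction
import Summits.QuantumFields.YangMills.Theorems.BalabanUVNodesN21ShellSplitOfRecord13CoPHKeyed

/-!
# BalabanUVNodes ∕ N21 face at the spine reading of record — CANONICAL FORM (the N21 twin of `…N20KeyedRelWeightCanonical` ∕ `…Fraction`): for an ADMISSIBLE shell split
# (`0 ≤ sh ≤ weight` on the class set) `ShellWeightBound` at `crOfRecord₁₃(V)At K₀ jcut sh` ⟺ `Summable Wsh` for the ONE definite sequence `Wsh = wshInf …` ∈ [0, 1] — the LEAST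
# relative shell weight —, which is always admissible; and on a live tuple `Wsh K = sup_{|t| ≤ 1} max (Σ shA K t ∕ Z_{K₀+K}(t), Σ shB K t ∕ Z_{K₀+K+1}(t))`, the WORST-SOURCE
# SHELL FRACTION of the tuple's own dressed partition functions.  NE7c at the record under a split has NO residual letter: «those shell fractions are summable over K»
# (no `< 1` clause — `ShellWeightBound` carries none; U4′'s `W + Wsh < 1` is the joint budget, eventually automatic from summability)

Cell `pub-ymgap` (HUMAN RULING D-0062 Track A; work-bound push D-0149, director-ym №197), width seat `pub-ymgap-dag-n20-w2` (gen 2); CLAIM-5 of the re-seat, the N21 companion of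
CLAIM-2∕3 (the N21 face AT `crOfRecord₁₃` has been this row's since plan g79 (D) ∕ g81 № 12: dag-n20-w1's shell socket p587734, gen 0's zero-split face p593923).  Filed `--kind proof
--supports stmt-QuantumFields-20544 --as helper` (K3⁷ `SpineGivenEndpointR13SepCoPH`); COUNT-NEUTRAL; LOCATED.  dag-n21-d's split OF RECORD `shellSplitOfRecord₁₃At N K₀ ρA ρB` (p592363
∕ `…Keyed`) is CONSUMED BY NAME in §4, nothing of it re-typed.  [III] = [Balaban1988Convergent], [LF-I∕II] = [Balaban1989LargeFieldI∕II], [UV3] = [Balaban1985UV3].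

WHAT IS PROVED (folklore real analysis over `T4IndicatorShell.ShellWeightBound` :403 and dag-n20-d's `admWsh ∕ wshInf`; 0 `sorry`):
* §1 (generic `ι`; hypotheses: the four TERM-WISE clauses `0 ≤ shA ≤ A`, `0 ≤ shB ≤ B` on `T K`, `|t| ≤ l₀`) `one_mem_admWsh` · `admWsh_nonempty` · `wshInf_mem` · `wshInf_le_one` ·
  `shell_left_wshInf ∕ shell_right_wshInf` · ★ `shellWeightBound_wshInf_iff_summable` (`ShellWeightBound … (wshInf …) ↔ Summable (wshInf …)` — the weight clauses hold at `wshInf`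
  unconditionally, the term-wise clauses are the hypotheses) · `exists_shellWeightBound_iff_summable` · `wshInf_eq_zero_of_shell_sums_eq_zero`; with POSITIVE totals and `0 ≤ l₀`:
  `shellFrac_left_le_wshInf ∕ _right` · ★ `wshInf_eq_sSup_shellFrac`;
* §2 (the reading of record, ANY split `sh` with the term-wise clauses DISPLAYED at the tuple) `Wsh_crOfRecord₁₃VAt_le_one` · ★★ `shellWeightBound_crOfRecord₁₃VAt_iff_summable` · `…At…` twin;
* §3 (live line, (H-U)∕(H-ζ)) ★★ `Wsh_crOfRecord₁₃VAt_eq_sSup_shellFrac` (`Wsh K = sup_{|t| ≤ 1} max (Σ shA ∕ Z_{K₀+K}, Σ shB ∕ Z_{K₀+K+1})`);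
* §4 (dag-n21-d's SPLIT OF RECORD `shellSplitOfRecord₁₃At N K₀ ρA ρB`, its integrability rows `hintA ∕ hintB` DISPLAYED as in `…Keyed`, `0 ≤ ζ` read off `hP`) ★★
  `shellWeightBound_crOfRecord₁₃VAt_splitOfRecord_iff_summable` — N21 at the reading with the split of record ⟺ `Summable Wsh`.
HONEST FRAMING.  Bookkeeping BY NAME; NO shell weight bounded, NO estimate proved; LOCATED, count-neutral.  Nothing of Bałaban's asserted; NE7 ∕ NE7b ∕ NE7c NOT PRINTED for `d = 4`,
NOT proved; (α)-instance 0∕1; no `Provisos₁₃CoPH` inhabitant claimed (K0⁷ OPEN); N19 ∕ N20 ∕ N21 ∕ N27 NOT discharged; K3⁷ NOT closed; counts unmoved (typed 28∕28 · discharged 5∕27);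
no count claim.  One finite `𝕋⁴_{L^K}` programme at fixed `ε = L^{−K}`, Bałaban AS PRINTED; the YM mass gap (Clay) is NOT proved by any of this — R4 closes the conditional finite-𝕋⁴
rung `BalabanLadder.UV` only; NOT ℝ⁴, NOT infinite volume, NOT OS.  No `def`, no `instance`, no `notation`, no `sorry`.  Sources (locators, bookkeeping only): [III] (2.18) p.257;
[LF-I] (0.2)–(0.4) p.176; [LF-II] Thm 1 + (0.1) pp.355–356; [UV3] (6) p.257; [King1986] (3.10)–(3.11) p.656.
-/

noncomputable section

open scoped BigOperators
open MeasureTheory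

namespace Summit.QuantumFields.YangMills.BalabanUVNodes.N21KeyedShellWeightCanonical

open Literature.MathematicalPhysics.QuantumFieldTheory.Balaban1983to89 Literature.MathematicalPhysics.QuantumFieldTheory.Balaban1983to89.Node00
open T4Continuum
open T4IndicatorShell (ShellWeightBound)
open YMDAG.UVSplit hiding SU
open Summit.QuantumFields.YangMills.BalabanUVNodes.SpineCanonicalWeights
open Summit.QuantumFields.YangMills.Theorems.N20AtRecord13 (schemeZ_pos_datumOfRecord₁₃CoPH)
open Summit.QuantumFields.YangMills.BalabanUVNodes.N21KeyedShellWeightShellZero (zeta_nonneg_of_provisos₁₃CoPH weightA₁₃_nonneg weightB₁₃_nonneg)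
open Summit.QuantumFields.YangMills.Theorems.N21ShellSplitOfRecord13CoPH
  (shellA₁₃ shellB₁₃ WidthLetter₁₃CoPH shellSplitOfRecord₁₃At shellA₁₃_nonneg shellB₁₃_nonneg shellA₁₃_le_weightA₁₃ shellB₁₃_le_weightB₁₃)
open Summit.QuantumFields.YangMills.BalabanUVNodes.N20KeyedRelWeightFraction (sum_classSet₁₃_weightA_pos_of_sel sum_classSet₁₃_weightB_pos_of_sel)

/-! ## §1  Folklore: for an admissible split the weight `1` is admissible, the canonical shell weight is attained and `≤ 1`, and `ShellWeightBound` at it is ONE condition -/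

section Generic

variable {ι : Type*} {l₀ : ℝ} {T : ℕ → Finset ι} {A B shA shB : ℕ → ℝ → ι → ℝ}
  (h0A : ∀ (K : ℕ) (t : ℝ), |t| ≤ l₀ → ∀ τ ∈ T K, 0 ≤ shA K t τ) (hleA : ∀ (K : ℕ) (t : ℝ), |t| ≤ l₀ → ∀ τ ∈ T K, shA K t τ ≤ A K t τ)
  (h0B : ∀ (K : ℕ) (t : ℝ), |t| ≤ l₀ → ∀ τ ∈ T K, 0 ≤ shB K t τ) (hleB : ∀ (K : ℕ) (t : ℝ), |t| ≤ l₀ → ∀ τ ∈ T K, shB K t τ ≤ B K t τ)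
include hleA hleB

/-- **THE WEIGHT `1` IS AN ADMISSIBLE SHELL WEIGHT** when the shell parts never exceed the terms. [cite: King1986, (3.10)–(3.11) p.656 (bookkeeping)] -/
theorem one_mem_admWsh (K : ℕ) : (1 : ℝ) ∈ admWsh l₀ T A B shA shB K := by
  refine ⟨zero_le_one, fun t ht => ⟨?_, ?_⟩⟩
  · rw [one_mul]; exact Finset.sum_le_sum fun τ hτ => hleA K t ht τ hτ
  · rw [one_mul]; exact Finset.sum_le_sum fun τ hτ => hleB K t ht τ hτ

/-- … so the admissible shell weights are non-empty, [cite: King1986, (3.10)–(3.11) p.656 (bookkeeping)] -/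
theorem admWsh_nonempty (K : ℕ) : (admWsh l₀ T A B shA shB K).Nonempty :=
  ⟨1, one_mem_admWsh hleA hleB K⟩

/-- … the canonical shell weight IS admissible, [cite: King1986, (3.10)–(3.11) p.656 (bookkeeping)] -/
theorem wshInf_mem (K : ℕ) : wshInf l₀ T A B shA shB K ∈ admWsh l₀ T A B shA shB K :=
  wshInf_mem_of_nonempty (admWsh_nonempty hleA hleB K)

/-- … and `≤ 1`. [cite: King1986, (3.10)–(3.11) p.656 (bookkeeping)] -/
theorem wshInf_le_one (K : ℕ) : wshInf l₀ T A B shA shB K ≤ 1 :=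
  csInf_le (bddBelow_admWsh l₀ T A B shA shB K) (one_mem_admWsh hleA hleB K)

/-- **THE CANONICAL SHELL WEIGHT IS A RELATIVE SHELL WEIGHT, run A**: `Σ shA ≤ wshInf K · Σ A` on `|t| ≤ l₀`. [cite: King1986, (3.10)–(3.11) p.656 (bookkeeping)] -/
theorem shell_left_wshInf (K : ℕ) {t : ℝ} (ht : |t| ≤ l₀) : ∑ τ ∈ T K, shA K t τ ≤ wshInf l₀ T A B shA shB K * ∑ τ ∈ T K, A K t τ :=
  ((wshInf_mem hleA hleB K).2 t ht).1

/-- **… run B.** [cite: King1986, (3.10)–(3.11) p.656 (bookkeeping)] -/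
theorem shell_right_wshInf (K : ℕ) {t : ℝ} (ht : |t| ≤ l₀) : ∑ τ ∈ T K, shB K t τ ≤ wshInf l₀ T A B shA shB K * ∑ τ ∈ T K, B K t τ :=
  ((wshInf_mem hleA hleB K).2 t ht).2

include h0A h0B

/-- **★ FOR AN ADMISSIBLE SPLIT, `ShellWeightBound` AT THE CANONICAL SHELL WEIGHT ⟺ `Summable wshInf`** — the four term-wise clauses are the hypotheses, the three weight clauses hold
at `wshInf` unconditionally; NO `< 1` clause exists in `ShellWeightBound`. [cite: King1986, (3.10)–(3.11) p.656; Balaban1989LargeFieldI, (0.2)–(0.4) p.176 (bookkeeping)] -/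
theorem shellWeightBound_wshInf_iff_summable :
    ShellWeightBound l₀ T A B shA shB (wshInf l₀ T A B shA shB) ↔ Summable (wshInf l₀ T A B shA shB) := by
  refine ⟨fun h => h.summable, fun hs => ?_⟩
  exact
    { nonneg := wshInf_nonneg
      summable := hs
      sh_nonneg_left := h0A
      sh_le_left := hleA
      sh_nonneg_right := h0B
      sh_le_right := hleB
      left := fun K t ht => shell_left_wshInf hleA hleB K ht
      right := fun K t ht => shell_right_wshInf hleA hleB K ht }

/-- **★ SOME `ShellWeightBound` EXISTS ⟺ `Summable wshInf`** (dag-n20-d's `shellWeightBound_wshInf_iff` + the above). [cite: King1986, (3.10)–(3.11) p.656 (bookkeeping)] -/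
theorem exists_shellWeightBound_iff_summable :
    (∃ Wsh : ℕ → ℝ, ShellWeightBound l₀ T A B shA shB Wsh) ↔ Summable (wshInf l₀ T A B shA shB) := by
  rw [← shellWeightBound_wshInf_iff, shellWeightBound_wshInf_iff_summable h0A hleA h0B hleB]

omit h0A hleA h0B hleB in
/-- **THE CANONICAL SHELL WEIGHT OF A VANISHING SHELL IS `0`.** [cite: King1986, (3.10)–(3.11) p.656 (bookkeeping)] -/
theorem wshInf_eq_zero_of_shell_sums_eq_zero {K : ℕ} (hA0 : ∀ t : ℝ, |t| ≤ l₀ → ∑ τ ∈ T K, shA K t τ = 0) (hB0 : ∀ t : ℝ, |t| ≤ l₀ → ∑ τ ∈ T K, shB K t τ = 0) :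
    wshInf l₀ T A B shA shB K = 0 :=
  le_antisymm (csInf_le (bddBelow_admWsh l₀ T A B shA shB K) ⟨le_rfl, fun t ht => ⟨by rw [hA0 t ht, zero_mul], by rw [hB0 t ht, zero_mul]⟩⟩) (wshInf_nonneg K)

variable (htotA : ∀ (K : ℕ) (t : ℝ), |t| ≤ l₀ → 0 < ∑ τ ∈ T K, A K t τ) (htotB : ∀ (K : ℕ) (t : ℝ), |t| ≤ l₀ → 0 < ∑ τ ∈ T K, B K t τ)

omit h0A h0B in
/-- With positive totals the canonical shell weight dominates run A's SHELL FRACTION. [cite: King1986, (3.10)–(3.11) p.656 (bookkeeping)] -/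
theorem shellFrac_left_le_wshInf (K : ℕ) {t : ℝ} (ht : |t| ≤ l₀) (hpos : 0 < ∑ τ ∈ T K, A K t τ) :
    (∑ τ ∈ T K, shA K t τ) / ∑ τ ∈ T K, A K t τ ≤ wshInf l₀ T A B shA shB K :=
  (div_le_iff₀ hpos).2 (shell_left_wshInf hleA hleB K ht)

omit h0A h0B in
/-- … and run B's. [cite: King1986, (3.10)–(3.11) p.656 (bookkeeping)] -/
theorem shellFrac_right_le_wshInf (K : ℕ) {t : ℝ} (ht : |t| ≤ l₀) (hpos : 0 < ∑ τ ∈ T K, B K t τ) :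
    (∑ τ ∈ T K, shB K t τ) / ∑ τ ∈ T K, B K t τ ≤ wshInf l₀ T A B shA shB K :=
  (div_le_iff₀ hpos).2 (shell_right_wshInf hleA hleB K ht)

include htotA htotB

omit h0B in
/-- **★ WITH POSITIVE TOTALS THE CANONICAL SHELL WEIGHT IS THE WORST-SOURCE SHELL FRACTION**: `wshInf … K = sup_{|t| ≤ l₀} max (Σ shA ∕ Σ A) (Σ shB ∕ Σ B)` (`0 ≤ l₀`).
[cite: King1986, (3.10)–(3.11) p.656; Balaban1989LargeFieldI, (0.2)–(0.4) p.176 (bookkeeping)] -/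
theorem wshInf_eq_sSup_shellFrac (hl₀ : 0 ≤ l₀) (K : ℕ) :
    wshInf l₀ T A B shA shB K =
      sSup ((fun t : ℝ => max ((∑ τ ∈ T K, shA K t τ) / ∑ τ ∈ T K, A K t τ) ((∑ τ ∈ T K, shB K t τ) / ∑ τ ∈ T K, B K t τ)) '' {t : ℝ | |t| ≤ l₀}) := by
  have h0 : |(0 : ℝ)| ≤ l₀ := by simpa [abs_zero] using hl₀
  have hbdd : BddAbove ((fun t : ℝ => max ((∑ τ ∈ T K, shA K t τ) / ∑ τ ∈ T K, A K t τ) ((∑ τ ∈ T K, shB K t τ) / ∑ τ ∈ T K, B K t τ)) '' {t : ℝ | |t| ≤ l₀}) :=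
    ⟨wshInf l₀ T A B shA shB K, by
      rintro _ ⟨t, ht, rfl⟩
      exact max_le (shellFrac_left_le_wshInf hleA hleB K ht (htotA K t ht)) (shellFrac_right_le_wshInf hleA hleB K ht (htotB K t ht))⟩
  have hle : ∀ t : ℝ, |t| ≤ l₀ → max ((∑ τ ∈ T K, shA K t τ) / ∑ τ ∈ T K, A K t τ) ((∑ τ ∈ T K, shB K t τ) / ∑ τ ∈ T K, B K t τ) ≤
      sSup ((fun t : ℝ => max ((∑ τ ∈ T K, shA K t τ) / ∑ τ ∈ T K, A K t τ) ((∑ τ ∈ T K, shB K t τ) / ∑ τ ∈ T K, B K t τ)) '' {t : ℝ | |t| ≤ l₀}) :=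
    fun t ht => le_csSup hbdd ⟨t, ht, rfl⟩
  have hmem : sSup ((fun t : ℝ => max ((∑ τ ∈ T K, shA K t τ) / ∑ τ ∈ T K, A K t τ) ((∑ τ ∈ T K, shB K t τ) / ∑ τ ∈ T K, B K t τ)) '' {t : ℝ | |t| ≤ l₀}) ∈
      admWsh l₀ T A B shA shB K := by
    refine ⟨?_, fun t ht => ⟨?_, ?_⟩⟩
    · exact le_trans (le_max_of_le_left (div_nonneg (Finset.sum_nonneg fun τ hτ => h0A K 0 h0 τ hτ) (htotA K 0 h0).le)) (hle 0 h0)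
    · exact (div_le_iff₀ (htotA K t ht)).1 ((le_max_left _ _).trans (hle t ht))
    · exact (div_le_iff₀ (htotB K t ht)).1 ((le_max_right _ _).trans (hle t ht))
  refine le_antisymm (csInf_le (bddBelow_admWsh l₀ T A B shA shB K) hmem) (csSup_le ⟨_, 0, h0, rfl⟩ ?_)
  rintro _ ⟨t, ht, rfl⟩
  exact max_le (shellFrac_left_le_wshInf hleA hleB K ht (htotA K t ht)) (shellFrac_right_le_wshInf hleA hleB K ht (htotB K t ht))

end Generic

/-! ## §2  At the spine reading of record, ANY split with the term-wise clauses displayed: the N21 face is `Summable Wsh` -/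

section Reading

variable {F : T4Family} {N : ℕ} [NeZero N] (θ : Stage13HParams F N) (hP : θ.Provisos₁₃CoPH F N) (K₀ : ℕ) (g₀ : ℕ → ℝ) (os : List (ULoop F)) (jcut : ℕ → ℕ)
  (sh : ShellSplit₁₃CoPH N K₀)
  (h0A : ∀ (K : ℕ) (t : ℝ), |t| ≤ 1 → ∀ x ∈ classSet₁₃ θ K₀ g₀ K, 0 ≤ (sh F θ hP g₀ os).1 K t x)
  (hleA : ∀ (K : ℕ) (t : ℝ), |t| ≤ 1 → ∀ x ∈ classSet₁₃ θ K₀ g₀ K, (sh F θ hP g₀ os).1 K t x ≤ weightA₁₃ θ hP K₀ g₀ os K t x)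
  (h0B : ∀ (K : ℕ) (t : ℝ), |t| ≤ 1 → ∀ x ∈ classSet₁₃ θ K₀ g₀ K, 0 ≤ (sh F θ hP g₀ os).2 K t x)
  (hleB : ∀ (K : ℕ) (t : ℝ), |t| ≤ 1 → ∀ x ∈ classSet₁₃ θ K₀ g₀ K, (sh F θ hP g₀ os).2 K t x ≤ weightB₁₃ θ hP K₀ g₀ os K t x)
include hleA hleB

/-- **THE READING's CANONICAL SHELL WEIGHT IS `≤ 1`** for a split whose shells never exceed the keyed weights. [cite: King1986, (3.10)–(3.11) p.656 (bookkeeping)] -/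
theorem Wsh_crOfRecord₁₃VAt_le_one (K : ℕ) : (crOfRecord₁₃VAt K₀ jcut sh F θ hP g₀ os).Wsh K ≤ 1 :=
  wshInf_le_one hleA hleB K

include h0A h0B

/-- **★★ THE N21 FACE AT THE SPINE READING OF RECORD (PHYSICAL VOLUME) IS ONE CONDITION ON ITS OWN `Wsh`** — for ANY split `sh` whose term-wise clauses `0 ≤ sh ≤ weight` hold at the
tuple (DISPLAYED): `ShellWeightBound (cr…).l₀ (cr…).T (cr…).A (cr…).B (cr…).shA (cr…).shB (cr…).Wsh ⟺ Summable (cr…).Wsh` at `cr… := crOfRecord₁₃VAt K₀ jcut sh F θ hP g₀ os`.  So NE7c AT THE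
RECORD under the split `sh` reads: «the canonical relative shell weights are summable over `K`» — nothing else. [cite: King1986, (3.10)–(3.11) p.656; Balaban1989LargeFieldI, (0.2)–(0.4) p.176; Balaban1989LargeFieldII, Thm 1 + (0.1) pp.355–356 (bookkeeping)] -/
theorem shellWeightBound_crOfRecord₁₃VAt_iff_summable :
    ShellWeightBound (crOfRecord₁₃VAt K₀ jcut sh F θ hP g₀ os).l₀ (crOfRecord₁₃VAt K₀ jcut sh F θ hP g₀ os).T (crOfRecord₁₃VAt K₀ jcut sh F θ hP g₀ os).A
        (crOfRecord₁₃VAt K₀ jcut sh F θ hP g₀ os).B (crOfRecord₁₃VAt K₀ jcut sh F θ hP g₀ os).shA (crOfRecord₁₃VAt K₀ jcut sh F θ hP g₀ os).shB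
        (crOfRecord₁₃VAt K₀ jcut sh F θ hP g₀ os).Wsh ↔
      Summable (crOfRecord₁₃VAt K₀ jcut sh F θ hP g₀ os).Wsh :=
  shellWeightBound_wshInf_iff_summable h0A hleA h0B hleB

/-- **THE v1.0 TWIN** (`crOfRecord₁₃At`). [cite: King1986, (3.10)–(3.11) p.656; Balaban1989LargeFieldII, Thm 1 + (0.1) pp.355–356 (bookkeeping)] -/
theorem shellWeightBound_crOfRecord₁₃At_iff_summable :
    ShellWeightBound (crOfRecord₁₃At K₀ jcut sh F θ hP g₀ os).l₀ (crOfRecord₁₃At K₀ jcut sh F θ hP g₀ os).T (crOfRecord₁₃At K₀ jcut sh F θ hP g₀ os).A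
        (crOfRecord₁₃At K₀ jcut sh F θ hP g₀ os).B (crOfRecord₁₃At K₀ jcut sh F θ hP g₀ os).shA (crOfRecord₁₃At K₀ jcut sh F θ hP g₀ os).shB
        (crOfRecord₁₃At K₀ jcut sh F θ hP g₀ os).Wsh ↔
      Summable (crOfRecord₁₃At K₀ jcut sh F θ hP g₀ os).Wsh :=
  shellWeightBound_wshInf_iff_summable h0A hleA h0B hleB

/-- **SOME WITNESS AT THE CARRIERS ⟺ `Summable Wsh` AT THE READING** (converse bookkeeping of dag-n20-d's `shellWeightBound_crOfRecord₁₃VAt`).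
[cite: King1986, (3.10)–(3.11) p.656 (bookkeeping)] -/
theorem exists_shellWeightBound_carriers₁₃_iff_summable :
    (∃ Wsh : ℕ → ℝ, ShellWeightBound 1 (classSet₁₃ θ K₀ g₀) (weightA₁₃ θ hP K₀ g₀ os) (weightB₁₃ θ hP K₀ g₀ os) (sh F θ hP g₀ os).1 (sh F θ hP g₀ os).2 Wsh) ↔
      Summable (crOfRecord₁₃VAt K₀ jcut sh F θ hP g₀ os).Wsh :=
  exists_shellWeightBound_iff_summable h0A hleA h0B hleB

/-! ## §3  On the live line the canonical shell weight is the worst-source shell fraction of the dressed partition functions -/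

variable (E : B12.RunParams → ℝ) (hsel : θ.ppSel = ppSelLiveOfRecord F N θ.ν θ.τ9 E (wOfRecord₉ F N θ.toStage9Params)) (hU : LocalBgMeasurable F N θ.ν)
  (hζm : ZetaMeasurable F N θ.ζ)
include hsel hU hζm

omit h0B in
/-- **★★ `Wsh K = sup_{|t| ≤ 1} max ( Σ_x shA K t x ∕ Z_{K₀+K}(t) , Σ_x shB K t x ∕ Z_{K₀+K+1}(t) )`** at `crOfRecord₁₃VAt K₀ jcut sh …` on the live-selector line under (H-U) ∕ (H-ζ) (E1 ∕ E2 +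
`schemeZ_pos_datumOfRecord₁₃CoPH`): NE7c at the record under the split `sh` = «the worst-source shell fractions of the tuple's own dressed partition functions are summable over `K`».
[cite: Balaban1985UV3, (6) p.257; King1986, (3.10)–(3.11) p.656; Balaban1989LargeFieldI, (0.2)–(0.4) p.176 (bookkeeping)] -/
theorem Wsh_crOfRecord₁₃VAt_eq_sSup_shellFrac (K : ℕ) :
    (crOfRecord₁₃VAt K₀ jcut sh F θ hP g₀ os).Wsh K =
      sSup ((fun t : ℝ => max
          ((∑ x ∈ classSet₁₃ θ K₀ g₀ K, (sh F θ hP g₀ os).1 K t x) / T4GenFunBounds.schemeZ ((datumOfRecord₁₃CoPH F N θ hP).scheme g₀) os (K₀ + K) t)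
          ((∑ x ∈ classSet₁₃ θ K₀ g₀ K, (sh F θ hP g₀ os).2 K t x) / T4GenFunBounds.schemeZ ((datumOfRecord₁₃CoPH F N θ hP).scheme g₀) os (K₀ + K + 1) t)) ''
        {t : ℝ | |t| ≤ 1}) := by
  have h := wshInf_eq_sSup_shellFrac (l₀ := 1) (T := classSet₁₃ θ K₀ g₀) (A := weightA₁₃ θ hP K₀ g₀ os) (B := weightB₁₃ θ hP K₀ g₀ os)
    (shA := (sh F θ hP g₀ os).1) (shB := (sh F θ hP g₀ os).2) h0A hleA hleB
    (fun K t _ => sum_classSet₁₃_weightA_pos_of_sel θ hP K₀ g₀ os E hsel hU hζm K t) (fun K t _ => sum_classSet₁₃_weightB_pos_of_sel θ hP K₀ g₀ os E hsel hU hζm K t) zero_le_one K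
  refine h.trans ?_
  congr 1
  refine Set.image_congr fun t _ => ?_
  rw [schemeZ_eq_sum_classSet_weightA K₀ θ hP E hsel hU hζm (zeta_nonneg_of_provisos₁₃CoPH F θ hP) g₀ os K t,
    schemeZ_succ_eq_sum_classSet_weightB K₀ θ hP E hsel hU hζm (zeta_nonneg_of_provisos₁₃CoPH F θ hP) g₀ os K t]

end Reading

/-! ## §4  At dag-n21-d's SHELL SPLIT OF RECORD the term-wise clauses are THEOREMS (integrability rows displayed): N21 there ⟺ `Summable Wsh` -/

section SplitOfRecord

variable {F : T4Family} {N : ℕ} [NeZero N] (θ : Stage13HParams F N) (hP : θ.Provisos₁₃CoPH F N) (K₀ : ℕ) (g₀ : ℕ → ℝ) (os : List (ULoop F)) (jcut : ℕ → ℕ)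
  (ρA ρB : WidthLetter₁₃CoPH N)
  (hintA : ∀ (K : ℕ) (t : ℝ) (s : SeqOfRecord F θ.ν θ.τ9.M (histA₁₃ θ K₀ g₀ K) (K₀ + K) (K₀ + K)),
    Integrable (fun V => chiSeqOfRecord F N θ.ν θ.τ9.M (histA₁₃ θ K₀ g₀ K) (K₀ + K) (K₀ + K) s V *
      dressedSlotsOfDatum₉ F N θ.toStage9Params (datumOfRecord₁₃CoPH F N θ hP) g₀ os t (runA₁₃ F K₀ g₀ K) (histA₁₃ θ K₀ g₀ K) (K₀ + K) s V)
      (fieldMeasure (F.P (K₀ + K)) (K₀ + K) (SU N)))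
  (hintB : ∀ (K : ℕ) (t : ℝ) (s' : SeqOfRecord F θ.ν θ.τ9.M (histB₁₃ θ K₀ g₀ K) (K₀ + K + 1) (K₀ + K + 1)),
    Integrable (fun V => chiSeqOfRecord F N θ.ν θ.τ9.M (histB₁₃ θ K₀ g₀ K) (K₀ + K + 1) (K₀ + K + 1) s' V *
      dressedSlotsOfDatum₉ F N θ.toStage9Params (datumOfRecord₁₃CoPH F N θ hP) g₀ os t (runB₁₃ F K₀ g₀ K) (histB₁₃ θ K₀ g₀ K) (K₀ + K + 1) s' V)
      (fieldMeasure (F.P (K₀ + K + 1)) (K₀ + K + 1) (SU N)))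
include hintA hintB

/-- **★★ THE N21 FACE AT THE READING OF RECORD WITH dag-n21-d's SHELL SPLIT OF RECORD ⟺ `Summable Wsh`** (`shellSplitOfRecord₁₃At N K₀ ρA ρB`, any width letters; the term-wise clauses
are dag-n21-d's `shellA∕B₁₃_nonneg` ∕ `shellA₁₃_le_weightA₁₃` ∕ `shellB₁₃_le_weightB₁₃` with `0 ≤ ζ` read off `hP` and F3's (e1) integrability rows `hintA ∕ hintB` DISPLAYED, as in `…Keyed`).
[cite: King1986, (3.10)–(3.11) p.656; Balaban1989LargeFieldI, (0.2)–(0.4) p.176; Balaban1989LargeFieldII, Thm 1 + (0.1) pp.355–356 (bookkeeping)] -/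
theorem shellWeightBound_crOfRecord₁₃VAt_splitOfRecord_iff_summable :
    ShellWeightBound (crOfRecord₁₃VAt K₀ jcut (shellSplitOfRecord₁₃At N K₀ ρA ρB) F θ hP g₀ os).l₀ (crOfRecord₁₃VAt K₀ jcut (shellSplitOfRecord₁₃At N K₀ ρA ρB) F θ hP g₀ os).T
        (crOfRecord₁₃VAt K₀ jcut (shellSplitOfRecord₁₃At N K₀ ρA ρB) F θ hP g₀ os).A (crOfRecord₁₃VAt K₀ jcut (shellSplitOfRecord₁₃At N K₀ ρA ρB) F θ hP g₀ os).B
        (crOfRecord₁₃VAt K₀ jcut (shellSplitOfRecord₁₃At N K₀ ρA ρB) F θ hP g₀ os).shA (crOfRecord₁₃VAt K₀ jcut (shellSplitOfRecord₁₃At N K₀ ρA ρB) F θ hP g₀ os).shB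
        (crOfRecord₁₃VAt K₀ jcut (shellSplitOfRecord₁₃At N K₀ ρA ρB) F θ hP g₀ os).Wsh ↔
      Summable (crOfRecord₁₃VAt K₀ jcut (shellSplitOfRecord₁₃At N K₀ ρA ρB) F θ hP g₀ os).Wsh :=
  shellWeightBound_crOfRecord₁₃VAt_iff_summable θ hP K₀ g₀ os jcut (shellSplitOfRecord₁₃At N K₀ ρA ρB)
    (fun K t _ x _ => shellA₁₃_nonneg K₀ θ hP g₀ os (zeta_nonneg_of_provisos₁₃CoPH F θ hP) _ K t x)
    (fun K t _ x _ => shellA₁₃_le_weightA₁₃ K₀ θ hP g₀ os (zeta_nonneg_of_provisos₁₃CoPH F θ hP) hintA _ K t x)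
    (fun K t _ x _ => shellB₁₃_nonneg K₀ θ hP g₀ os (zeta_nonneg_of_provisos₁₃CoPH F θ hP) _ K t x)
    (fun K t _ x _ => shellB₁₃_le_weightB₁₃ K₀ θ hP g₀ os (zeta_nonneg_of_provisos₁₃CoPH F θ hP) hintB _ K t x)

/-- **… AND ITS CANONICAL SHELL WEIGHT IS `≤ 1`.** [cite: King1986, (3.10)–(3.11) p.656 (bookkeeping)] -/
theorem Wsh_crOfRecord₁₃VAt_splitOfRecord_le_one (K : ℕ) : (crOfRecord₁₃VAt K₀ jcut (shellSplitOfRecord₁₃At N K₀ ρA ρB) F θ hP g₀ os).Wsh K ≤ 1 :=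
  Wsh_crOfRecord₁₃VAt_le_one θ hP K₀ g₀ os jcut (shellSplitOfRecord₁₃At N K₀ ρA ρB)
    (fun K t _ x _ => shellA₁₃_le_weightA₁₃ K₀ θ hP g₀ os (zeta_nonneg_of_provisos₁₃CoPH F θ hP) hintA _ K t x)
    (fun K t _ x _ => shellB₁₃_le_weightB₁₃ K₀ θ hP g₀ os (zeta_nonneg_of_provisos₁₃CoPH F θ hP) hintB _ K t x) K

end SplitOfRecord

end Summit.QuantumFields.YangMills.BalabanUVNodes.N21KeyedShellWeightCanonical

end
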